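import Summits.NavierStokesRegularity.NavierStokesRegularity.Theses.AngularGalerkinLadder
import Summits.NavierStokesRegularity.NavierStokesRegularity.Theorems.NoOverheating.Negative.SineFormAlignmentExcluded
import HarnessLib

/-!
# Census stratum (S14): no K2 window profile — and no witness of K1 — has vorticity bounded on a
# backward parabolic cylinder at the space–time origin (Beale–Kato–Majda read on the ladder)

Refuter seat (ns-blowup-refuter g17), kernel census for crux K2 `NoOverheating`
(stmt-NavierStokesRegularity-19960) of route `AngularGalerkinLadder`, Negative lane (`--supports`).
No definition, no named fact, no item verdict moves; nothing is asserted about Navier–Stokes.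

The most quoted regularity criterion, Beale–Kato–Majda 1984 (blow-up at time `T` forces
`∫^T ‖ω(t)‖_∞ dt = ∞`), has an exact KINEMATIC shadow on the profile class of the ladder: under
the rotated discrete self-similarity `c Rᵀu(c²t, cRx) = u(t, x)` vorticity MAGNITUDES obey
`|ω(t, x)| = c⁻² |ω(t/c², c⁻¹R⁻¹x)|` (`norm_curl_slice_eq_of_isRotatedDSS`, KJ-46), so a bound
`|ω| ≤ M` on one backward parabolic cylinder `Q_ρ(0,0) = (−ρ², 0) × B_ρ(0)` propagates to
`|ω| ≤ M/(c²)ᵏ` on `Q_{cᵏρ}(0,0)`; every `(t, x)` with `t < 0` lies in these for all large `k`,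
so the vorticity vanishes IDENTICALLY on `t < 0` (`curl_eq_zero_of_norm_curl_le_parabolicCylinder`
— Chae–Wolf's §3 step 1 run on `ω` instead of `u`; no equation).  An irrotational rung-profile
slice is zero (harmonic Liouville + Type-I decay, KJ-49
`rungProfile_slice_eq_zero_of_parallelVorticity` with `e = 0`), whence:

* `no_windowProfile_boundedVorticity` — (S14) a single window profile (`0 < δ`) with vorticity
  bounded on some `Q_ρ(0,0)` is contradictory; in particular vorticity bounded on a window strip
  `(−ρ², 0) × ℝ³`, or on `(−∞, 0) × ℝ³`, is excluded (`no_windowProfile_boundedVorticity_strip`);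
* `not_nontrivial_rungProfile_of_boundedVorticity` — the same for K1's witnesses
  (`RungIsSingular L`): a nontrivial rung profile has UNBOUNDED vorticity on every `Q_ρ(0,0)`;
* `not_cofinal_and_noOverheating_boundedVorticity` — the K1 ∧ K2 supply reading.

References: [cite: BealeKatoMajda1984, Theorem 1]; [cite: ChaeWolf2017, §3, Step 1];
[cite: KochNadirashviliSereginSverak2009, (1.6)].
-/

noncomputable section

namespace Summit.NavierStokesRegularity.AngularGalerkinLadderBoundedVorticityExcluded

open Set Function Filter Topology Metric
open Literature.Analysis Literature.Analysis.FluidPDE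
open Summit.NavierStokesRegularity.FluidComputer
open Summit.NavierStokesRegularity.FluidComputer.AngularLadder
open Summit.NavierStokesRegularity.NavierStokesRegularity.Theses.AngularGalerkinLadder
open Summit.NavierStokesRegularity.AngularGalerkinLadderRotatedDSSVorticityDirection
open Summit.NavierStokesRegularity.AngularGalerkinLadderSineFormAlignmentExcluded

/-! ### §1 Kinematics: bounded vorticity near the origin forces zero vorticity -/

section Kinematics

variable {c : ℝ} {R : EuclideanSpace ℝ (Fin 3) ≃ₗᵢ[ℝ] EuclideanSpace ℝ (Fin 3)}
  {u : ℝ → EuclideanSpace ℝ (Fin 3) → EuclideanSpace ℝ (Fin 3)}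

/-- Membership in the backward parabolic cylinder at the space–time origin,
`(t, x) ∈ Q_r(0,0) ↔ −r² < t < 0 ∧ ‖x‖ < r`. [folklore] -/
theorem mem_parabolicCylinder_origin {r t : ℝ} {x : EuclideanSpace ℝ (Fin 3)} :
    ((t, x) : ℝ × EuclideanSpace ℝ (Fin 3)) ∈
        parabolicCylinder r (0 : ℝ × EuclideanSpace ℝ (Fin 3)) ↔
      (-r ^ 2 < t ∧ t < 0) ∧ ‖x‖ < r := by
  simp [mem_parabolicCylinder, dist_zero_right]

/-- **Propagation of a vorticity bound outward.** If `|curl u| ≤ M` on `Q_ρ(0,0)` then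
`|curl u| ≤ M/(c²)ᵏ` on `Q_{cᵏρ}(0,0)`: the contracted preimage `(t/c², c⁻¹R⁻¹x)` of a point of
`Q_{c^{k+1}ρ}` lies in `Q_{cᵏρ}`, and vorticity magnitudes scale by `c⁻²` across one period.
[cite: ChaeWolf2017, §3, Step 1] -/
theorem norm_curl_le_of_mem_parabolicCylinder_pow (h : IsRotatedDSS c R u) (hc : 1 < c)
    {ρ M : ℝ}
    (hM : ∀ z ∈ parabolicCylinder ρ (0 : ℝ × EuclideanSpace ℝ (Fin 3)), ‖curl (u z.1) z.2‖ ≤ M)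
    (k : ℕ) : ∀ t : ℝ, ∀ x : EuclideanSpace ℝ (Fin 3),
      ((t, x) : ℝ × EuclideanSpace ℝ (Fin 3)) ∈
          parabolicCylinder (c ^ k * ρ) (0 : ℝ × EuclideanSpace ℝ (Fin 3)) →
        ‖curl (u t) x‖ ≤ M / (c ^ 2) ^ k := by
  have hc0 : 0 < c := zero_lt_one.trans hc
  induction k with
  | zero =>
    intro t x hz
    simpa using hM (t, x) (by simpa using hz)
  | succ k ih =>
    intro t x hz
    rw [mem_parabolicCylinder_origin] at hz
    obtain ⟨⟨ht1, ht2⟩, hx⟩ := hz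
    have hz' : ((t / c ^ 2, c⁻¹ • R.symm x) : ℝ × EuclideanSpace ℝ (Fin 3)) ∈
        parabolicCylinder (c ^ k * ρ) (0 : ℝ × EuclideanSpace ℝ (Fin 3)) := by
      rw [mem_parabolicCylinder_origin]
      refine ⟨⟨?_, ?_⟩, ?_⟩
      · rw [lt_div_iff₀ (pow_pos hc0 2)]
        have : (c ^ (k + 1) * ρ) ^ 2 = (c ^ k * ρ) ^ 2 * c ^ 2 := by ring
        linarith
      · exact div_neg_of_neg_of_pos ht2 (pow_pos hc0 2)
      · rw [norm_smul, LinearIsometryEquiv.norm_map, Real.norm_of_nonneg (inv_nonneg.2 hc0.le),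
          inv_mul_lt_iff₀ hc0]
        calc ‖x‖ < c ^ (k + 1) * ρ := hx
          _ = c * (c ^ k * ρ) := by ring
    calc ‖curl (u t) x‖ = (c⁻¹) ^ 2 * ‖curl (u (t / c ^ 2)) (c⁻¹ • R.symm x)‖ :=
        norm_curl_slice_eq_of_isRotatedDSS h hc0.ne' t x
      _ ≤ (c⁻¹) ^ 2 * (M / (c ^ 2) ^ k) :=
        mul_le_mul_of_nonneg_left (ih _ _ hz') (sq_nonneg _)
      _ = M / (c ^ 2) ^ (k + 1) := by rw [pow_succ, inv_pow]; field_simp; ring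

/-- **A rotated-DSS field (`1 < c`) whose vorticity is bounded on one backward parabolic cylinder
`Q_ρ(0,0)`, `ρ > 0`, has identically vanishing vorticity on `t < 0`** — Beale–Kato–Majda's
necessary condition read kinematically on the self-similar class: `(t, x) ∈ Q_{cᵏρ}` for all
large `k` and `M/(c²)ᵏ → 0`. [cite: BealeKatoMajda1984, Theorem 1] -/
theorem curl_eq_zero_of_norm_curl_le_parabolicCylinder (h : IsRotatedDSS c R u) (hc : 1 < c)
    {ρ M : ℝ} (hρ : 0 < ρ)
    (hM : ∀ z ∈ parabolicCylinder ρ (0 : ℝ × EuclideanSpace ℝ (Fin 3)), ‖curl (u z.1) z.2‖ ≤ M) :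
    ∀ t < 0, ∀ x, curl (u t) x = 0 := by
  intro t ht x
  have hc2 : 1 < c ^ 2 := by nlinarith
  have hgrow : Tendsto (fun k : ℕ => c ^ k * ρ) atTop atTop :=
    (tendsto_pow_atTop_atTop_of_one_lt hc).atTop_mul_const hρ
  have hev : ∀ᶠ k : ℕ in atTop, ‖curl (u t) x‖ ≤ M / (c ^ 2) ^ k := by
    filter_upwards [hgrow.eventually_gt_atTop ‖x‖, hgrow.eventually_gt_atTop (Real.sqrt (-t))]
      with k hkx hkt
    refine norm_curl_le_of_mem_parabolicCylinder_pow h hc hM k t x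
      (mem_parabolicCylinder_origin.2 ⟨⟨?_, ht⟩, hkx⟩)
    have hs : 0 ≤ Real.sqrt (-t) := Real.sqrt_nonneg _
    have h1 : Real.sqrt (-t) ^ 2 < (c ^ k * ρ) ^ 2 := by gcongr
    rw [Real.sq_sqrt (by linarith)] at h1
    linarith
  have hlim : Tendsto (fun k : ℕ => M / (c ^ 2) ^ k) atTop (𝓝 0) :=
    tendsto_const_nhds.div_atTop (tendsto_pow_atTop_atTop_of_one_lt hc2)
  exact norm_le_zero_iff.1 (ge_of_tendsto hlim hev)

/-- The strip form: vorticity bounded on a window strip `(−ρ², 0) × ℝ³` is bounded on `Q_ρ(0,0)`.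
[folklore] -/
theorem curl_eq_zero_of_norm_curl_le_strip (h : IsRotatedDSS c R u) (hc : 1 < c) {ρ M : ℝ}
    (hρ : 0 < ρ) (hM : ∀ s ∈ Ioo (-ρ ^ 2) 0, ∀ x, ‖curl (u s) x‖ ≤ M) :
    ∀ t < 0, ∀ x, curl (u t) x = 0 :=
  curl_eq_zero_of_norm_curl_le_parabolicCylinder h hc hρ fun z hz => by
    rw [mem_parabolicCylinder] at hz
    exact hM z.1 (by simpa using hz.1) z.2

end Kinematics

/-! ### §2 Rung profiles, window profiles, K1's witnesses -/

variable {L : ℕ} {C₀ cmin cmax δ ε c : ℝ}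
  {R : EuclideanSpace ℝ (Fin 3) ≃ₗᵢ[ℝ] EuclideanSpace ℝ (Fin 3)}
  {u : ℝ → EuclideanSpace ℝ (Fin 3) → EuclideanSpace ℝ (Fin 3)}
  {p : ℝ → EuclideanSpace ℝ (Fin 3) → ℝ}
  {d : ℝ → EuclideanSpace ℝ (Fin 3) → EuclideanSpace ℝ (Fin 3)}

/-- **A rung profile with vorticity bounded on some `Q_ρ(0,0)` vanishes at every negative time**:
its slices are irrotational (§1), divergence free, `C²` and bounded, hence constant (harmonic
Liouville) and then zero by Type-I decay. [cite: BealeKatoMajda1984, Theorem 1] -/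
theorem rungProfile_eq_zero_of_boundedVorticity (hP : IsRungProfile L C₀ c R u p d) {ρ M : ℝ}
    (hρ : 0 < ρ)
    (hM : ∀ z ∈ parabolicCylinder ρ (0 : ℝ × EuclideanSpace ℝ (Fin 3)), ‖curl (u z.1) z.2‖ ≤ M) :
    ∀ t < 0, ∀ x, u t x = 0 := fun t ht =>
  rungProfile_slice_eq_zero_of_parallelVorticity hP ht (e := 0) fun x =>
    ⟨0, by rw [curl_eq_zero_of_norm_curl_le_parabolicCylinder hP.isRotatedDSS hP.one_lt hρ hM t ht x,
      zero_smul]⟩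

/-- **(S14) for K1's witnesses**: a NONTRIVIAL rung profile (a witness of `RungIsSingular L`) has
unbounded vorticity on every backward parabolic cylinder at the space–time origin.
[cite: BealeKatoMajda1984, Theorem 1] -/
theorem not_nontrivial_rungProfile_of_boundedVorticity (hP : IsRungProfile L C₀ c R u p d)
    {ρ M : ℝ} (hρ : 0 < ρ)
    (hM : ∀ z ∈ parabolicCylinder ρ (0 : ℝ × EuclideanSpace ℝ (Fin 3)), ‖curl (u z.1) z.2‖ ≤ M) :
    ¬ ∃ t < 0, ∃ x, u t x ≠ 0 := by
  rintro ⟨t, ht, x, hx⟩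
  exact hx (rungProfile_eq_zero_of_boundedVorticity hP hρ hM t ht x)

/-- **(S14) NO WINDOW PROFILE HAS VORTICITY BOUNDED NEAR THE SPACE–TIME ORIGIN**: a single window
profile with `0 < δ` whose vorticity is bounded on some `Q_ρ(0,0)` contradicts the amplitude floor
`‖u(−1, x₀)‖ ≥ δ`. [cite: BealeKatoMajda1984, Theorem 1] -/
theorem no_windowProfile_boundedVorticity (hδ : 0 < δ)
    (hW : IsWindowProfile L C₀ cmin cmax δ ε c R u p d) {ρ M : ℝ} (hρ : 0 < ρ)
    (hM : ∀ z ∈ parabolicCylinder ρ (0 : ℝ × EuclideanSpace ℝ (Fin 3)), ‖curl (u z.1) z.2‖ ≤ M) :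
    False := by
  obtain ⟨hP, -, -, ⟨x₀, hx₀⟩, -⟩ := hW
  rw [rungProfile_eq_zero_of_boundedVorticity hP hρ hM (-1) (by norm_num) x₀, norm_zero] at hx₀
  exact absurd hx₀ (not_le.2 hδ)

/-- The strip form of (S14): vorticity bounded on a window strip `(−ρ², 0) × ℝ³` (a fortiori on all
of `(−∞, 0) × ℝ³`) is excluded. [cite: BealeKatoMajda1984, Theorem 1] -/
theorem no_windowProfile_boundedVorticity_strip (hδ : 0 < δ)
    (hW : IsWindowProfile L C₀ cmin cmax δ ε c R u p d) {ρ M : ℝ} (hρ : 0 < ρ)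
    (hM : ∀ s ∈ Ioo (-ρ ^ 2) 0, ∀ x, ‖curl (u s) x‖ ≤ M) : False :=
  no_windowProfile_boundedVorticity hδ hW hρ fun z hz => by
    rw [mem_parabolicCylinder] at hz
    exact hM z.1 (by simpa using hz.1) z.2

/-! ### §3 The K1 ∧ K2 reading -/

/-- **K1 ∧ (K2 supplied by window profiles with vorticity bounded near the origin) is
contradictory** — at the FIRST singular rung past `L₀`; radius and bound may depend on the rung.
[cite: BealeKatoMajda1984, Theorem 1] -/
theorem not_cofinal_and_noOverheating_boundedVorticity (C₀ : ℝ) :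
    ¬ (RungBlowupCofinal ∧ ∃ (cmin cmax δ : ℝ) (L₀ : ℕ) (ε : ℕ → ℝ), 1 < cmin ∧ 0 < δ ∧
        Tendsto ε atTop (𝓝 0) ∧ ∀ L ≥ L₀, RungIsSingular L →
          ∃ (c : ℝ) (R : EuclideanSpace ℝ (Fin 3) ≃ₗᵢ[ℝ] EuclideanSpace ℝ (Fin 3))
            (u : ℝ → EuclideanSpace ℝ (Fin 3) → EuclideanSpace ℝ (Fin 3))
            (p : ℝ → EuclideanSpace ℝ (Fin 3) → ℝ)
            (d : ℝ → EuclideanSpace ℝ (Fin 3) → EuclideanSpace ℝ (Fin 3)),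
            IsWindowProfile L C₀ cmin cmax δ (ε L) c R u p d ∧
              ∃ ρ M : ℝ, 0 < ρ ∧
                ∀ z ∈ parabolicCylinder ρ (0 : ℝ × EuclideanSpace ℝ (Fin 3)),
                  ‖curl (u z.1) z.2‖ ≤ M) := by
  rintro ⟨hK1, cmin, cmax, δ, L₀, ε, -, hδ, -, hsup⟩
  obtain ⟨L, hL, hsing⟩ := hK1 L₀
  obtain ⟨c, R, u, p, d, hW, ρ, M, hρ, hM⟩ := hsup L hL hsing
  exact no_windowProfile_boundedVorticity hδ hW hρ hM

end Summit.NavierStokesRegularity.AngularGalerkinLadderBoundedVorticityExcluded
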